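import Literature.MathematicalPhysics.QuantumLattice.InfVolFermionStateParticleHoleHubbardEnergy
import Literature.MathematicalPhysics.QuantumLattice.UniformMagnetisationNumericCertificates
import HarnessLib

/-!
# The particle–hole symmetry of lattice-fermion pressures; `P(β; μ, h) = P(β; U − μ, −h) + β(2μ − U)` for the
# Hubbard model in every dimension

The staggered particle–hole automorphism `α` (`c_{xσ} ↦ ε_x c†_{xσ}`, `ε_x = (−1)^{Σ x_i}`) is in the tree on every local algebra
(`phAut Λ`, inner and involutive, compatible with isotony, translation covariant up to the grading — `InfVolFermionStateParticleHole`) and on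
states (`ω.particleHole`). Here it is lifted to INTERACTIONS and to the thermodynamic-limit variational pressures:

* §1 `Ψ.particleHole` (`Φ X ↦ α_X(Φ X)`): local Hamiltonians are conjugated by the unitary `P_Λ`, so **all box partition functions agree**
  (`partitionFn_particleHole_localHamiltonian`); Hermitian / even / finite range are preserved, and so are translation covariance and
  `q`-periodicity FOR EVEN interactions (odd translations cost a `Θ`, invisible on even terms).
* §2 **`P_q(β, Ψ^α) = P_q(β, Ψ)`, `P(β, Ψ^α) = P(β, Ψ)`** for every real `β` (`perVarPressure_particleHole`, `varPressure_particleHole`; box limits).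
* §3 the identity interaction `onSiteUnit d` (`Φ{x} = 1`): its mean energy is `1` in every state, and `P(β, Ψ + c·𝟙) = P(β, Ψ) − βc`
  (`varPressure_pencil_onSiteUnit`).
* §4 **the image of the Hubbard model**: `(Φ^{t,U} + a n + b s)^α = (Φ^{t,U} + (−U − a) n + (−b) s) + (U + 2a)·𝟙` (`particleHole_hubbardZeeman`;
  the tree's `phAut_hubbardΦ_singleton/_pair`), hence for `d ≥ 1`, every real `β`, `R ≥ 1`:
  **`P(β; a, b) = P(β; −U − a, −b) − β(U + 2a)`** (`varPressure_hubbardZeeman_particleHole`) — in the usual variables (`a = −μ`, `b = −h`)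
  `P(β; μ, h) = P(β; U − μ, −h) + β(2μ − U)`: the grand-canonical pressure of the Hubbard model on `ℤ^d` is symmetric about half filling
  `μ = U/2`. (The tree had this for the canonical / grand-canonical `t–t'` pressures on `ℤ²` via torus limits; here it is the variational
  pressure of `TIVariationalPressure`, any `d`, any real `β`, nearest-neighbour hopping.)

Everything is PROVED; definitions with bodies: `FermionInteraction.particleHole`, `onSiteUnit`. No named fact, no number.
HONEST SCOPE: bipartite (nearest-neighbour) hopping only — a `t'` term changes sign under `α` and is not treated here.

## Tree / Mathlib search

REUSED: `phAut`, `phAut_nAt`, `phAut_phAut`, `phAut_conjTranspose`, `parityAut_phAut`, `fermionEmbed_incl_phAut`, `fermionEmbed_shiftEmb_phAut_of_eq_one/_neg_one`,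
`siteStagger_eq_one_or`, `particleHoleAut_apply`, `particleHole_conjTranspose_mul` (`InfVolFermionStateParticleHole`, `HubbardModelParticleHoleProofs`);
`phAut_hubbardΦ_singleton/_pair` (`InfVolFermionStateParticleHoleHubbardEnergy`); `fermionEmbed_parityAut`; `pencil`, `meanEnergy_pencil`, `meanEnergy_of_onSite`;
`hubbardZeeman(_structure/_apply_singleton/_apply_pair/_apply_eq_zero)` (`UniformMagnetisation…`); `tendsto_boxLogPartitionFn_perVarPressure`,
`perVarPressure_eq_varPressure`; Mathlib `Matrix.exp_conj`, `Matrix.trace_mul_cycle`. Pattern of `partitionFn_conj_of_mul_eq_one` (`BlochBogoliubovImplementer`, not imported).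

## References

* E. H. Lieb, Phys. Rev. Lett. 62 (1989) 1201, proof of Theorem 2 (the particle–hole unitary on a bipartite lattice).
* H. Tasaki, *Physics and Mathematics of Quantum Many-Body Systems* (2020), §9.3.3.
* R. B. Israel, *Convexity in the Theory of Lattice Gases* (1979), Thm. I.2.4, §IV.2.
-/

noncomputable section

open scoped ComplexOrder BigOperators
open Finset Filter Topology

namespace Literature.MathematicalPhysics.QuantumLattice

open Matrix HubbardWave0 Literature.Probability.LatticeModels ThermodynamicLimit

variable {d : ℕ}

/-! ### §1. The particle–hole transformed interaction -/

/-- **Similar Hamiltonians have the same partition function**: `W'W = 1 ⇒ Tr e^{−βWXW'} = Tr e^{−βX}` (adapted from `BlochBogoliubovImplementer`).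
[folklore] -/
private theorem partitionFn_conj_of_mul_eq_one' {n : Type*} [Fintype n] [DecidableEq n] {W W' : Matrix n n ℂ}
    (h : W' * W = 1) (β : ℝ) (X : Matrix n n ℂ) :
    Matrix.partitionFn β (W * X * W') = Matrix.partitionFn β X := by
  have hW : IsUnit W := (Matrix.isUnit_iff_isUnit_det W).2 (Matrix.isUnit_det_of_left_inverse h)
  have hW' : W' = W⁻¹ := (Matrix.inv_eq_left_inv h).symm
  rw [Matrix.partitionFn, Matrix.partitionFn, Matrix.gibbsWeight, Matrix.gibbsWeight, hW', ← Matrix.smul_mul, ← Matrix.mul_smul,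
    Matrix.exp_conj _ _ hW, Matrix.trace_mul_cycle, Matrix.nonsing_inv_mul _ ((Matrix.isUnit_iff_isUnit_det W).1 hW), Matrix.one_mul]

/-- `Pᴴ P = 1` for the staggered particle–hole unitary of a region. [cite: Tasaki2020, §9.3.3] -/
theorem phUnitary_conjTranspose_mul (Λ : Finset (Site d)) :
    (particleHole (fun i : Orb (PolySite Λ) => (((phSign Λ i : ℤˣ) : ℤ) : ℂ)))ᴴ *
        particleHole (fun i : Orb (PolySite Λ) => (((phSign Λ i : ℤˣ) : ℤ) : ℂ)) = 1 :=
  particleHole_conjTranspose_mul _ fun i => by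
    rcases Int.units_eq_one_or (phSign Λ i) with h | h <;> simp [h]

/-- **All partition functions are particle–hole invariant on a region**: `Tr e^{−β α_Λ(H)} = Tr e^{−βH}`. [cite: LiebPRL1989, proof of Theorem 2] -/
theorem partitionFn_phAut (β : ℝ) {Λ : Finset (Site d)} (H : FermionOp Λ) :
    Matrix.partitionFn β (phAut Λ H) = Matrix.partitionFn β H := by
  rw [phAut, particleHoleAut_apply]
  exact partitionFn_conj_of_mul_eq_one' (phUnitary_conjTranspose_mul Λ) β H

namespace FermionInteraction

/-- **The particle–hole transformed interaction** `Ψ^α`: `Φ^α X = α_X(Φ X)`. [cite: Tasaki2020, §9.3.3] -/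
def particleHole (Ψ : FermionInteraction d) : FermionInteraction d where
  Φ X := phAut X (Ψ.Φ X)

variable (Ψ : FermionInteraction d)

/-- The terms of `Ψ^α` (definitional). [cite: Tasaki2020, §9.3.3] -/
theorem particleHole_apply (X : Finset (Site d)) : Ψ.particleHole.Φ X = phAut X (Ψ.Φ X) := rfl

/-- `Ψ^α^α = Ψ`. [cite: Tasaki2020, §9.3.3] -/
theorem particleHole_particleHole : Ψ.particleHole.particleHole = Ψ :=
  FermionInteraction.ext fun X => by rw [particleHole_apply, particleHole_apply, phAut_phAut]

/-- **The local Hamiltonians of `Ψ^α` are the transformed local Hamiltonians.** [cite: LiebPRL1989, proof of Theorem 2] -/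
theorem particleHole_localHamiltonian (Λ : Finset (Site d)) : Ψ.particleHole.localHamiltonian Λ = phAut Λ (Ψ.localHamiltonian Λ) := by
  unfold localHamiltonian
  rw [map_sum]
  exact Finset.sum_congr rfl fun X _ => fermionEmbed_incl_phAut _ _

/-- **All box partition functions of `Ψ^α` and `Ψ` agree.** [cite: LiebPRL1989, proof of Theorem 2] -/
theorem partitionFn_particleHole_localHamiltonian (β : ℝ) (Λ : Finset (Site d)) :
    Matrix.partitionFn β (Ψ.particleHole.localHamiltonian Λ) = Matrix.partitionFn β (Ψ.localHamiltonian Λ) := by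
  rw [particleHole_localHamiltonian, partitionFn_phAut]

variable {Ψ} {R : ℝ} {q : Fin d → ℕ}

/-- `Ψ^α` is Hermitian if `Ψ` is. [cite: ArakiMoriya2003, §1 assumption (II)] -/
theorem IsHermitian.particleHole (h : Ψ.IsHermitian) : Ψ.particleHole.IsHermitian := fun X => by
  unfold Matrix.IsHermitian
  rw [particleHole_apply, ← phAut_conjTranspose, (h X).eq]

/-- `Ψ^α` is even if `Ψ` is. [cite: ArakiMoriya2003, §1 assumption (II)] -/
theorem IsEven.particleHole (h : Ψ.IsEven) : Ψ.particleHole.IsEven := fun X => by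
  rw [particleHole_apply, parityAut_phAut, h X]

/-- `Ψ^α` has the range of `Ψ`. [cite: ArakiMoriya2003, §5.4] -/
theorem HasFiniteRange.particleHole (h : Ψ.HasFiniteRange R) : Ψ.particleHole.HasFiniteRange R := fun X hX => by
  rw [particleHole_apply, h X hX, map_zero]

/-- Transport of a covariance identity through `α` (even terms; translation by any `v`). [cite: ArakiMoriya2003, §4.1 Def. 4.3] -/
theorem particleHole_shift_aux (hE : Ψ.IsEven) (v : Site d) (X : Finset (Site d))
    (hT : Ψ.Φ (shiftSet v X) = fermionEmbed (PolySite.shiftEmb v X) (Ψ.Φ X)) :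
    Ψ.particleHole.Φ (shiftSet v X) = fermionEmbed (PolySite.shiftEmb v X) (Ψ.particleHole.Φ X) := by
  rw [particleHole_apply, particleHole_apply, hT]
  rcases siteStagger_eq_one_or v with hv | hv
  · rw [fermionEmbed_shiftEmb_phAut_of_eq_one hv]
  · rw [fermionEmbed_shiftEmb_phAut_of_eq_neg_one hv, ← fermionEmbed_parityAut, hE X]

/-- `Ψ^α` is translation covariant if `Ψ` is translation covariant AND EVEN. [cite: ArakiMoriya2003, §1 assumption (IV)] -/
theorem IsTranslationInvariant.particleHole (h : Ψ.IsTranslationInvariant) (hE : Ψ.IsEven) : Ψ.particleHole.IsTranslationInvariant :=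
  fun v X => particleHole_shift_aux hE v X (h v X)

/-- `Ψ^α` is `q`-periodic if `Ψ` is `q`-periodic and even. [cite: ArakiMoriya2003, §1 assumption (IV) and §8] -/
theorem IsPeriodic.particleHole (h : Ψ.IsPeriodic q) (hE : Ψ.IsEven) : Ψ.particleHole.IsPeriodic q :=
  fun z X => particleHole_shift_aux hE _ X (h z X)

/-! ### §2. The pressures are particle–hole invariant -/

/-- **`P_q(β, Ψ^α) = P_q(β, Ψ)`** (`q`-periodic Hermitian even finite-range `Ψ`, every real `β`, `d ≥ 1`): both are the limit of the same aligned-box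
pressures. [cite: Israel1979, Thm. I.2.4] [cite: LiebPRL1989, proof of Theorem 2] -/
theorem perVarPressure_particleHole (hd : 0 < d) (hH : Ψ.IsHermitian) (hE : Ψ.IsEven) (hΨ : Ψ.IsPeriodic q) (hR : Ψ.HasFiniteRange R) (β : ℝ) :
    Ψ.particleHole.perVarPressure β q R = Ψ.perVarPressure β q R := by
  have h1 := tendsto_boxLogPartitionFn_perVarPressure hd hH.particleHole hE.particleHole (hΨ.particleHole hE) hR.particleHole β
  have h2 := tendsto_boxLogPartitionFn_perVarPressure hd hH hE hΨ hR β
  simp only [partitionFn_particleHole_localHamiltonian] at h1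
  exact tendsto_nhds_unique h1 h2

/-- **`P(β, Ψ^α) = P(β, Ψ)`** for translation-covariant even `Ψ`. [cite: Israel1979, Thm. I.2.4] [cite: LiebPRL1989, proof of Theorem 2] -/
theorem varPressure_particleHole (hd : 0 < d) (hH : Ψ.IsHermitian) (hE : Ψ.IsEven) (hT : Ψ.IsTranslationInvariant) (hR : Ψ.HasFiniteRange R)
    (β : ℝ) : Ψ.particleHole.varPressure β R = Ψ.varPressure β R := by
  rw [← perVarPressure_eq_varPressure hd β (fun _ => 0) hT R, ← perVarPressure_eq_varPressure hd β (fun _ => 0) (hT.particleHole hE) R]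
  exact perVarPressure_particleHole hd hH hE (hT.isPeriodic _) hR β

end FermionInteraction

/-! ### §3. The identity interaction and constant energy shifts -/

/-- **The identity on-site interaction** `𝟙`: `Φ{x} = 1`, `Φ X = 0` otherwise (`H_Λ = |Λ|·1`): the direction of a constant energy shift per site.
[cite: ArakiMoriya2003, §5.1] -/
def onSiteUnit (d : ℕ) : FermionInteraction d where
  Φ X := ∑ x ∈ X.attach, if X = {x.1} then (1 : FermionOp X) else 0

/-- `𝟙{x} = 1`. [cite: ArakiMoriya2003, §5.1] -/
theorem onSiteUnit_apply_singleton (x : Site d) : (onSiteUnit d).Φ {x} = 1 := by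
  simp only [onSiteUnit]
  rw [Finset.sum_eq_single ⟨x, mem_singleton_self x⟩, if_pos rfl]
  · rintro ⟨b, hb⟩ - hne
    exact absurd (Subtype.ext (mem_singleton.1 hb)) hne
  · intro h
    exact absurd (mem_attach _ _) h

/-- All other terms of `𝟙` vanish. [cite: ArakiMoriya2003, §5.1] -/
theorem onSiteUnit_apply_eq_zero {X : Finset (Site d)} (h1 : ∀ x : Site d, X ≠ {x}) : (onSiteUnit d).Φ X = 0 := by
  simp only [onSiteUnit, h1, if_false, sum_const_zero]

/-- Term of `𝟙` at a region known to be a singleton. [cite: ArakiMoriya2003, §5.1] -/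
theorem onSiteUnit_apply_of_eq_singleton {S : Finset (Site d)} {y : Site d} (hS : S = {y}) : (onSiteUnit d).Φ S = 1 := by
  subst hS
  exact onSiteUnit_apply_singleton y

/-- Structure of `𝟙`: Hermitian, even, translation covariant, of every range `R ≥ 0`. [cite: ArakiMoriya2003, §1 assumptions (II), (IV), §5.4] -/
theorem onSiteUnit_structure {R : ℝ} (hR : 0 ≤ R) :
    (onSiteUnit d).IsHermitian ∧ (onSiteUnit d).IsEven ∧ (onSiteUnit d).IsTranslationInvariant ∧ (onSiteUnit d).HasFiniteRange R := by
  refine ⟨fun X => ?_, fun X => ?_, fun v X => ?_, fun X hX => ?_⟩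
  · by_cases h1 : ∃ x : Site d, X = {x}
    · obtain ⟨x, rfl⟩ := h1
      rw [onSiteUnit_apply_singleton]
      exact Matrix.isHermitian_one
    · push Not at h1
      rw [onSiteUnit_apply_eq_zero h1]
      exact Matrix.isHermitian_zero
  · by_cases h1 : ∃ x : Site d, X = {x}
    · obtain ⟨x, rfl⟩ := h1
      rw [onSiteUnit_apply_singleton, map_one]
    · push Not at h1
      rw [onSiteUnit_apply_eq_zero h1, map_zero]
  · by_cases h1 : ∃ x : Site d, X = {x}
    · obtain ⟨x, rfl⟩ := h1
      rw [onSiteUnit_apply_of_eq_singleton (shiftSet_singleton_eq v x), onSiteUnit_apply_singleton, map_one]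
    · have hX : (onSiteUnit d).Φ X = 0 := onSiteUnit_apply_eq_zero fun x hx => h1 ⟨x, hx⟩
      have hS : (onSiteUnit d).Φ (shiftSet v X) = 0 :=
        onSiteUnit_apply_eq_zero fun y hy => h1 ⟨y - v, eq_singleton_of_shiftSet_eq hy⟩
      rw [hX, hS, map_zero]
  · refine onSiteUnit_apply_eq_zero fun x hx => ?_
    rw [hx, coe_singleton, Metric.diam_singleton] at hX
    exact absurd hX (not_lt.2 hR)

/-- **The mean energy of `𝟙` is `1` in every state.** [cite: BratteliKishimotoRobinson1978, §3 (mean energy functional)] -/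
theorem InfVolFermionState.meanEnergy_onSiteUnit (ω : InfVolFermionState d) (R : ℝ) : ω.meanEnergy (onSiteUnit d) R = 1 := by
  rw [ω.meanEnergy_of_onSite _ (fun _ h => onSiteUnit_apply_eq_zero h), onSiteUnit_apply_singleton, ω.expect_one, Complex.one_re]

/-- **A constant shift per site shifts the pressure**: `P(β, Ψ + c·𝟙) = P(β, Ψ) − βc`. [cite: Israel1979, Thm. I.2.4] -/
theorem FermionInteraction.varPressure_pencil_onSiteUnit (Ψ : FermionInteraction d) (c β R : ℝ) :
    (Ψ.pencil (onSiteUnit d) c).varPressure β R = Ψ.varPressure β R - β * c := by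
  refine le_antisymm ?_ ?_
  · refine (Ψ.pencil (onSiteUnit d) c).varPressure_le β R fun ω hω => ?_
    have h := Ψ.sub_mul_le_varPressure β R hω
    rw [ω.meanEnergy_pencil, ω.meanEnergy_onSiteUnit, mul_one]
    linarith
  · rw [sub_le_iff_le_add]
    refine Ψ.varPressure_le β R fun ω hω => ?_
    have h := (Ψ.pencil (onSiteUnit d) c).sub_mul_le_varPressure β R hω
    rw [ω.meanEnergy_pencil, ω.meanEnergy_onSiteUnit, mul_one] at h
    linarith

/-! ### §4. The image of the Hubbard model; the pressure identity -/

/-- **The particle–hole image of the Hubbard model in a chemical potential and a field**: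
`(Φ^{t,U} + a n + b s)^α = (Φ^{t,U} + (−U − a) n + (−b) s) + (U + 2a)·𝟙`. [cite: LiebPRL1989, proof of Theorem 2] [cite: Tasaki2020, §9.3.3] -/
theorem particleHole_hubbardZeeman (t U a b : ℝ) :
    (hubbardZeeman d t U ![a, b]).particleHole = (hubbardZeeman d t U ![-U - a, -b]).pencil (onSiteUnit d) (U + 2 * a) := by
  refine FermionInteraction.ext fun X => ?_
  rw [FermionInteraction.particleHole_apply, FermionInteraction.pencil_apply]
  by_cases h1 : ∃ x : Site d, X = {x}
  · obtain ⟨x, rfl⟩ := h1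
    rw [hubbardZeeman_apply_singleton, hubbardZeeman_apply_singleton, onSiteUnit_apply_singleton]
    simp only [Matrix.cons_val_zero, Matrix.cons_val_one, map_add, map_smul, map_sub, map_mul, phAut_nAt]
    set n0 : FermionOp ({x} : Finset (Site d)) := nAt x (mem_singleton_self x) 0
    set n1 : FermionOp ({x} : Finset (Site d)) := nAt x (mem_singleton_self x) 1
    have e1 : ((1 : FermionOp ({x} : Finset (Site d))) - n0) * (1 - n1) = n0 * n1 - n0 - n1 + 1 := by noncomm_ring
    rw [e1]
    simp only [Complex.ofReal_neg, Complex.ofReal_sub, Complex.ofReal_add, Complex.ofReal_mul, Complex.ofReal_ofNat]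
    module
  by_cases h2 : ∃ (x : Site d) (i : Fin d), X = {x, x + unitVec i}
  · obtain ⟨x, i, rfl⟩ := h2
    have hne : ∀ z : Site d, ({x, x + unitVec i} : Finset (Site d)) ≠ {z} := fun z hz => h1 ⟨z, hz⟩
    rw [hubbardZeeman_apply_pair, hubbardZeeman_apply_pair, onSiteUnit_apply_eq_zero hne, phAut_hubbardΦ_pair, smul_zero, add_zero]
  · push Not at h1 h2
    rw [hubbardZeeman_apply_eq_zero t U _ h1 (fun y i => h2 y i), hubbardZeeman_apply_eq_zero t U _ h1 (fun y i => h2 y i),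
      onSiteUnit_apply_eq_zero h1, map_zero, smul_zero, add_zero]

/-- **THE PARTICLE–HOLE IDENTITY OF THE HUBBARD PRESSURE** (every `d ≥ 1`, every real `β`, `R ≥ 1`):
`P(β; a, b) = P(β; −U − a, −b) − β(U + 2a)` for `Ψ = Φ^{t,U} + a n + b s`; i.e. with `a = −μ`, `b = −h`:
`P(β; μ, h) = P(β; U − μ, −h) + β(2μ − U)`. [cite: LiebPRL1989, proof of Theorem 2] [cite: Israel1979, Thm. I.2.4] -/
theorem varPressure_hubbardZeeman_particleHole (hd : 0 < d) (t U a b β : ℝ) {R : ℝ} (hR : 1 ≤ R) :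
    (hubbardZeeman d t U ![a, b]).varPressure β R = (hubbardZeeman d t U ![-U - a, -b]).varPressure β R - β * (U + 2 * a) := by
  obtain ⟨hH, hE, hT, hR1⟩ := hubbardZeeman_structure (d := d) t U ![a, b]
  have hRR : (hubbardZeeman d t U ![a, b]).HasFiniteRange R := fun X hX => hR1 X (lt_of_le_of_lt hR hX)
  rw [← FermionInteraction.varPressure_particleHole hd hH hE hT hRR β, particleHole_hubbardZeeman, FermionInteraction.varPressure_pencil_onSiteUnit]

/-- **Symmetry about half filling**: at `μ = U/2` (`a = −U/2`) and `h = 0` the model is its own particle–hole image, `Ψ^α = Ψ + 0·𝟙`.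
[cite: LiebPRL1989, proof of Theorem 2] -/
theorem particleHole_hubbardZeeman_halfFilling (t U : ℝ) :
    (hubbardZeeman d t U ![-U / 2, 0]).particleHole = hubbardZeeman d t U ![-U / 2, 0] := by
  rw [particleHole_hubbardZeeman]
  refine FermionInteraction.ext fun X => ?_
  rw [FermionInteraction.pencil_apply, show -U - -U / 2 = -U / 2 by ring, neg_zero, show U + 2 * (-U / 2) = 0 by ring, Complex.ofReal_zero,
    zero_smul, add_zero]

end Literature.MathematicalPhysics.QuantumLattice

end
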